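import Summits.AtomisticToContinuum.FouriersLaw.Theorems.BondHeatUncertaintySubdiffusiveBondHeatKernelGibbsF
import Summits.AtomisticToContinuum.FouriersLaw.Theorems.BondHeatUncertaintySubdiffusiveBondHeatGibbsMomentumFourthMoment
import Summits.AtomisticToContinuum.FouriersLaw.Theses.BoundaryEscapeDeficit

/-!
# `BoundaryEscapeDeficit.BoundaryKernelBasics` — proved

Item `stmt-AtomisticToContinuum-12239` (support, route `BoundaryEscapeDeficit`, sub-problem `FouriersLaw`): for
`pinnedChain ω₂ lam β γ` (all parameters `> 0`), every `N ≥ 1` and `T > 0`, with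
`K_N(u) = ∫ (p₀² - T)(P_{u⁺}(p₀² - T)) dμ_T` (constructed `transitionKernel` at equal bath temperatures, `gibbsMeasure`):
(a) `μ_T.bind P_t = μ_T` for all `t ≥ 0`; (b) `K_N` continuous; (c) `|K_N| ≤ 2T²`; (d) `|K_N(u)| ≤ C e^{-cu}` (`u ≥ 0`,
`c > 0`); (e) `K_N ∈ L¹(0,∞)`. Assembled from the kernel-Gibbs-invariance files
`BondHeatUncertaintySubdiffusiveBondHeatKernelGibbsA…F` (landed for crux stmt-AtomisticToContinuum-9120, line
`bath-bond-deficit-integral`) and the Gaussian momentum moments of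
`BondHeatUncertaintySubdiffusiveBondHeatGibbsMomentumFourthMoment` (`∫ p₀² dμ_T = T`, `∫ p₀⁴ dμ_T ≤ 3T²`).
-/

noncomputable section

open MeasureTheory ProbabilityTheory Filter Topology Set
open scoped NNReal ENNReal

namespace Summit.AtomisticToContinuum.FouriersLaw.Theorems.SubdiffusiveBondHeat

open Literature.MathematicalPhysics.KineticTheory.HeatConduction
open Literature.MathematicalPhysics.KineticTheory Literature.Probability.Process OscillatorChain

variable {N : ℕ}

/-! ### Statics of the boundary observable and the assembly of `BoundaryKernelBasics` -/

section Statics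

variable {ω₂ lam β γ : ℝ} (hω : 0 < ω₂) (hl : 0 ≤ lam) (hβ : 0 ≤ β) (γ : ℝ) (N : ℕ) {T : ℝ} (hT : 0 < T)
include hω hl hβ hT

/-- `∫ p_i² dμ_T = T` (Gaussian momentum marginal; integration by parts `∫ p² e^{-H/T} = T ∫ e^{-H/T}`). [folklore] -/
theorem pinnedChain_integral_sq_momentum_gibbsMeasure (i : Fin N) :
    ∫ z, z.2 i ^ 2 ∂((pinnedChain ω₂ lam β γ).gibbsMeasure N T) = T := by
  rw [(pinnedChain ω₂ lam β γ).integral_gibbsMeasure]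
  have h2 := pinnedChain_integral_momentum_pow_add_two hω hl hβ γ N hT i (k := 0) (Nat.zero_le _)
  have hZ : 0 < ∫ x, (pinnedChain ω₂ lam β γ).gibbsDensity N T x :=
    integral_exp_pos (pinnedChain_integrable_gibbsDensity hω hl hβ γ N hT)
  simp only [Nat.cast_zero, zero_add, mul_one, pow_zero, one_mul] at h2
  rw [h2]
  field_simp

/-- `∫ (p_i² - T) dμ_T = 0`. [folklore] -/
theorem pinnedChain_integral_kinObs_gibbsMeasure (i : Fin N) :
    ∫ z, (z.2 i ^ 2 - T) ∂((pinnedChain ω₂ lam β γ).gibbsMeasure N T) = 0 := by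
  haveI := pinnedChain_isProbabilityMeasure_gibbsMeasure hω hl hβ γ N hT
  have hi2 : Integrable (fun z : PhaseSpace N => z.2 i ^ 2) ((pinnedChain ω₂ lam β γ).gibbsMeasure N T) :=
    (pinnedChain ω₂ lam β γ).integrable_gibbsMeasure
      (pinnedChain_integrable_momentum_pow_mul_gibbsDensity hω hl hβ γ N hT i (by norm_num))
  rw [integral_sub hi2 (integrable_const T), integral_const,
    pinnedChain_integral_sq_momentum_gibbsMeasure hω hl hβ γ N hT i]
  simp [probReal_univ]

/-- `∫ (p_i² - T)² dμ_T ≤ 2T²` (indeed `= 3T² - 2T² + T²`). [folklore] -/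
theorem pinnedChain_integral_kinObs_sq_le (hl' : 0 < lam) (hβ' : 0 < β) (hγ : 0 < γ) (i : ℕ) (hi : i = 0)
    (hN : 0 < N) :
    ∫ z, (z.2 ⟨i, hi ▸ hN⟩ ^ 2 - T) ^ 2 ∂((pinnedChain ω₂ lam β γ).gibbsMeasure N T) ≤ 2 * T ^ 2 := by
  subst hi
  haveI := pinnedChain_isProbabilityMeasure_gibbsMeasure hω hl hβ γ N hT
  set j : Fin N := ⟨0, hN⟩
  obtain ⟨hi4, h4⟩ := stub_gibbsMomentumFourthMoment ω₂ lam β γ hω hl' hβ' hγ T hT N hN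
  have hi2 : Integrable (fun z : PhaseSpace N => z.2 j ^ 2) ((pinnedChain ω₂ lam β γ).gibbsMeasure N T) :=
    (pinnedChain ω₂ lam β γ).integrable_gibbsMeasure
      (pinnedChain_integrable_momentum_pow_mul_gibbsDensity hω hl hβ γ N hT j (by norm_num))
  have h2 := pinnedChain_integral_sq_momentum_gibbsMeasure hω hl hβ γ N hT j
  have e : (fun z : PhaseSpace N => (z.2 j ^ 2 - T) ^ 2) = fun z => z.2 j ^ 4 - 2 * T * z.2 j ^ 2 + T ^ 2 := by
    funext z; ring
  have i1 : Integrable (fun z : PhaseSpace N => z.2 j ^ 4 - 2 * T * z.2 j ^ 2) ((pinnedChain ω₂ lam β γ).gibbsMeasure N T) :=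
    hi4.sub (hi2.const_mul _)
  rw [e, integral_add i1 (integrable_const _), integral_sub hi4 (hi2.const_mul _), integral_const_mul,
    integral_const, h2]
  simp only [probReal_univ, smul_eq_mul, one_mul]
  nlinarith

end Statics

/-- **`BoundaryEscapeDeficit.BoundaryKernelBasics`, PROVED** (item stmt-AtomisticToContinuum-12239): for the pinned
anharmonic chain with all parameters positive, every `N ≥ 1` and `T > 0`: (a) the Gibbs measure is invariant under
the constructed transition kernels at equal bath temperatures; (b) `u ↦ K_N(u) = ⟨p₀² - T, P_{u⁺}(p₀² - T)⟩_{μ_T}` is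
continuous; (c) `|K_N(u)| ≤ 2T²`; (d) `|K_N(u)| ≤ C e^{-cu}` for `u ≥ 0` (some `c > 0`); (e) `K_N ∈ L¹(0, ∞)`.
[cite: CuneoEckmannHairerReyBellet2018, Thm 2.13 and §3.1] -/
theorem boundaryKernelBasics_proof :
    Summit.AtomisticToContinuum.FouriersLaw.Theses.BoundaryEscapeDeficit.BoundaryKernelBasics := by
  intro ω₂ lam β γ hω hl hβ hγ T hT N hN
  dsimp only
  simp only [dif_pos hN]
  have h0 := pinnedChain_integral_kinObs_gibbsMeasure hω hl.le hβ.le γ N hT ⟨0, hN⟩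
  have hsq := pinnedChain_integral_kinObs_sq_le hω hl.le hβ.le γ N hT hl hβ hγ 0 rfl hN
  refine ⟨fun t => pinnedChain_gibbsMeasure_bind_transitionKernel hω hl.le hβ.le hγ.le hN hT t,
    pinnedChain_continuous_kinCorr hω hl.le hβ hγ hN hT, fun u => ?_,
    pinnedChain_kinCorr_exp_decay hω hl.le hβ hγ hN hT h0,
    pinnedChain_kinCorr_integrableOn hω hl.le hβ hγ hN hT h0⟩
  exact pinnedChain_kinCorr_abs_le hω hl.le hβ hγ hN hT hsq u.toNNReal

end Summit.AtomisticToContinuum.FouriersLaw.Theorems.SubdiffusiveBondHeat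

end
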